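import Summits.ResolutionOfSingularities.ResolutionOfSingularities.Theorems.PurelyInseparableDim4TschirnhausFrame
import HarnessLib
import HarnessLib.Audit.Tags

/-!
# Purely inseparable four-folds — the Tschirnhaus / W-frame move: THE FRAME REPRODUCES under a point
# blow-up step (cell `res-dim4-pi`, K2(p) lane, brick (ii) FILE B, part 2)

[OURS · counted 0 · cell `res-dim4-pi` · brick (ii), shapes of record res-dim4-p-1 g2, this file
res-dim4-p-11 g2.]  Nothing here proves K2(p), `NoIsolatedTrap p p` or resolution of singularities in
dimension ≥ 4 / characteristic `p`.

Continuation of `…TschirnhausFrame` (the move `tsch f φ : x_f ↦ x_f + φ`, chart dictionary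
`pointTransform_tsch` with `φ′ := chartTransform 1 univ j φ`, `b⁺ := update b f (b f + eval b φ′)`,
`φ⁺ := translate b φ′ − C (eval b φ′)`).  Here:

* §4 **`initialForm_tsch_of_two_le`**: for `ord₀ φ ≥ 2` (the Tschirnhaus part) the initial form is
  unchanged (`tsch f φ F − F ∈ 𝔪₀^{ord₀ F + 1}`) — the residual cone, its vertex and the shade are read off
  unchanged (the state-level corollaries are FILE C's).
* at the level of the walk's states (`q = p`, characteristic `p`, the contact letter `f` FREE: `r_f = 0`,
  `f ∉ exc`; chart `j ≠ f`), §5 **`step_F_tsch`**: `(step p univ j b ⟨tsch f φ s.F, s.r, s.exc⟩).F =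
  deletePthPowers p (tsch f φ⁺ (step p univ j b⁺ s).F)` — the child of the re-coordinatised state is the
  re-coordinatised child, re-cleaned (`Straightening.deletePthPowers_aeval_deletePthPowers`); `step_r_tsch`,
  `step_exc_tsch`; and the new datum is again admissible: `constantCoeff_tschShift` (`φ⁺(0) = 0`),
  `not_mem_vars_tschShift` (`f ∉ φ⁺.vars`) — idea-4 I-4-7 (TS)(ii) «one frame serves the whole stretch».
* §6 `isEquimultiplePoint_tsch_iff`, `step_F_tsch_ne_zero_iff`, **`step0_tsch`**: equimultiple points,
  non-degeneracy and `Step0` edges correspond under `b ↦ b⁺`.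

bears_on: LADDER-RESOLUTION:D157-DOOR2 (res-dim4-pi · K2(p) · (ii)).  Supports
stmt-ResolutionOfSingularities-16155 (helper).
-/

set_option linter.dupNamespace false -- mandated namespace of this single-conjunct summit

noncomputable section

namespace Summit.ResolutionOfSingularities.ResolutionOfSingularities.Theorems.PIDim4

namespace FrameChange

open MvPolynomial Finset
open Literature.AlgebraicGeometry.Resolution
open Literature.AlgebraicGeometry.Resolution.Hauser2010
open Literature.AlgebraicGeometry.Resolution.HauserPerlega2019
open Literature.AlgebraicGeometry.Resolution.CentreBlowup
open PointBlowup (translate)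

variable {K : Type} [Field K]

variable {f : Fin 4} {φ : MvPolynomial (Fin 4) K}

/-! ## 4. The Tschirnhaus part (`ord₀ φ ≥ 2`) is inert on the initial form -/

/-- `(x_f + φ)^n − x_f^n ∈ 𝔪₀^{n+1}` for `φ ∈ 𝔪₀²`. [folklore] -/
theorem X_add_pow_sub_X_pow_mem (h2 : φ ∈ MvPolynomial.idealOfVars (Fin 4) K ^ 2) (n : ℕ) :
    (X f + φ) ^ n - X f ^ n ∈ MvPolynomial.idealOfVars (Fin 4) K ^ (n + 1) := by
  induction n with
  | zero => simp
  | succ n ih =>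
    have key : (X f + φ) ^ (n + 1) - X f ^ (n + 1) = (X f + φ) * ((X f + φ) ^ n - X f ^ n) + φ * X f ^ n := by
      ring
    rw [key]
    refine Ideal.add_mem _ ?_ ?_
    · rw [show n + 1 + 1 = 1 + (n + 1) by ring, pow_add]
      refine Ideal.mul_mem_mul ?_ ih
      rw [pow_one]
      exact Ideal.add_mem _ (Literature.RingTheory.MvPolynomial.X_mem_idealOfVars f)
        (Ideal.pow_le_self two_ne_zero h2)
    · rw [show n + 1 + 1 = 2 + n by ring, pow_add]
      exact Ideal.mul_mem_mul h2 (Literature.RingTheory.MvPolynomial.X_pow_mem_idealOfVars_pow f n)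

/-- On a monomial the Tschirnhaus part raises the order: `tsch f φ (c x^d) − c x^d ∈ 𝔪₀^{|d|+1}` for
`φ ∈ 𝔪₀²`. [folklore] -/
theorem tsch_monomial_sub_mem (h2 : φ ∈ MvPolynomial.idealOfVars (Fin 4) K ^ 2) (d : Fin 4 →₀ ℕ) (c : K) :
    tsch f φ (monomial d c) - monomial d c ∈ MvPolynomial.idealOfVars (Fin 4) K ^ (d.degree + 1) := by
  classical
  -- split `x^d = x^{d'} · x_f^n`, `d' = d.erase f`, `n = d f`
  have hsplit : monomial d c = monomial (d.erase f) c * X f ^ (d f) := by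
    rw [X_pow_eq_monomial, monomial_mul, mul_one, Finsupp.erase_add_single]
  have hdeg : d.degree = (d.erase f).degree + d f := by
    conv_lhs => rw [← Finsupp.erase_add_single f d]
    rw [map_add, Finsupp.degree_single]
  rw [hsplit, map_mul, tsch_monomial_of_apply_eq_zero φ (Finsupp.erase_same), map_pow, tsch_X_self,
    ← mul_sub, hdeg, add_assoc, pow_add]
  exact Ideal.mul_mem_mul (Literature.RingTheory.MvPolynomial.monomial_mem_idealOfVars_pow_of_le le_rfl c)
    (X_add_pow_sub_X_pow_mem h2 (d f))

/-- **`tsch f φ F − F ∈ 𝔪₀^{o+1}`** for `φ ∈ 𝔪₀²` and `o ≤ ord₀ F`. [folklore] -/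
theorem tsch_sub_self_mem (h2 : φ ∈ MvPolynomial.idealOfVars (Fin 4) K ^ 2) {F : MvPolynomial (Fin 4) K}
    {o : ℕ} (ho : (o : ℕ∞) ≤ ordZero F) :
    tsch f φ F - F ∈ MvPolynomial.idealOfVars (Fin 4) K ^ (o + 1) := by
  classical
  have hsum : tsch f φ F - F = ∑ d ∈ F.support, (tsch f φ (monomial d (coeff d F)) - monomial d (coeff d F)) := by
    conv_lhs => rw [F.as_sum]
    rw [map_sum, ← Finset.sum_sub_distrib]
  rw [hsum]
  refine Ideal.sum_mem _ fun d hd => ?_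
  have hod : o ≤ d.degree := by
    have h := Literature.Barriers.ResolutionOfSingularities.ordZero_le_of_coeff_ne_zero F d
      (MvPolynomial.mem_support_iff.mp hd)
    exact_mod_cast ho.trans h
  exact Ideal.pow_le_pow_right (by omega) (tsch_monomial_sub_mem h2 d (coeff d F))

/-- Two polynomials congruent modulo `𝔪₀ⁿ⁺¹` have the same degree-`n` component. [folklore] -/
theorem homogeneousComponent_eq_of_sub_mem {G H : MvPolynomial (Fin 4) K} {n : ℕ}
    (h : G - H ∈ MvPolynomial.idealOfVars (Fin 4) K ^ (n + 1)) :
    homogeneousComponent n G = homogeneousComponent n H := by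
  ext d
  rw [coeff_homogeneousComponent, coeff_homogeneousComponent]
  split_ifs with hd
  · have h' := Literature.RingTheory.MvPolynomial.coeff_eq_zero_of_mem_idealOfVars_pow h (d := d) (by omega)
    rwa [coeff_sub, sub_eq_zero] at h'
  · rfl

/-- `2 ≤ ord₀ φ` gives `φ ∈ 𝔪₀²` and `φ(0) = 0`. [folklore] -/
theorem mem_sq_of_two_le (h2 : (2 : ℕ∞) ≤ ordZero φ) :
    φ ∈ MvPolynomial.idealOfVars (Fin 4) K ^ 2 ∧ constantCoeff φ = 0 := by
  have h : ((2 : ℕ) : ℕ∞) ≤ ordZero φ := h2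
  refine ⟨(natCast_le_ordZero_iff_mem_idealOfVars_pow φ 2).mp h, ?_⟩
  exact (one_le_ordZero_iff φ).mp (le_trans (by norm_num) h2)

/-- **The Tschirnhaus part is inert on the initial form**: for `ord₀ φ ≥ 2` (and `f ∉ φ.vars`),
`in(tsch f φ F) = in(F)` — the residual cone, its vertex and the shade are read off unchanged.
[cite: Kollar2007, Aside 3.57] [folklore] -/
theorem initialForm_tsch_of_two_le (hφ : f ∉ φ.vars) (h2 : (2 : ℕ∞) ≤ ordZero φ)
    (F : MvPolynomial (Fin 4) K) : initialForm (tsch f φ F) = initialForm F := by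
  obtain ⟨hsq, h0⟩ := mem_sq_of_two_le h2
  unfold initialForm
  rw [ordZero_tsch hφ h0]
  by_cases hF : F = 0
  · subst hF; rw [map_zero]
  · refine homogeneousComponent_eq_of_sub_mem (tsch_sub_self_mem hsq ?_)
    exact (coe_toNat_ordZero hF).le

/-! ## 5. State level: the step of the re-coordinatised state -/

section Step

variable {j : Fin 4}

/-- `constantCoeff (translate b G) = G(b)`. [folklore] -/
theorem constantCoeff_translate (b : Fin 4 → K) (G : MvPolynomial (Fin 4) K) :
    constantCoeff (translate b G) = MvPolynomial.eval b G := by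
  unfold PointBlowup.translate
  have h : (constantCoeff : MvPolynomial (Fin 4) K →+* K).comp
      (aeval (R := K) fun i => (X i + C (b i) : MvPolynomial (Fin 4) K)).toRingHom =
      MvPolynomial.eval b := by
    refine MvPolynomial.ringHom_ext (fun c => ?_) (fun i => ?_)
    · simp
    · simp
  exact RingHom.congr_fun h G

/-- **The new datum fixes the origin**: `φ⁺(0) = 0`. [folklore] -/
theorem constantCoeff_tschShift (b : Fin 4 → K) (ψ : MvPolynomial (Fin 4) K) :
    constantCoeff (translate b ψ - C (MvPolynomial.eval b ψ)) = 0 := by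
  rw [map_sub, constantCoeff_C, constantCoeff_translate, sub_self]

/-- A translation does not create new letters. [folklore] -/
theorem vars_translate_subset (b : Fin 4 → K) (ψ : MvPolynomial (Fin 4) K) : (translate b ψ).vars ⊆ ψ.vars := by
  classical
  unfold PointBlowup.translate
  rw [MvPolynomial.aeval_eq_bind₁]
  refine (MvPolynomial.vars_bind₁ _ ψ).trans (Finset.biUnion_subset.mpr fun i hi => ?_)
  refine (MvPolynomial.vars_add_subset _ _).trans (Finset.union_subset ?_ ?_)
  · rw [MvPolynomial.vars_X]; exact Finset.singleton_subset_iff.mpr hi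
  · rw [MvPolynomial.vars_C]; exact Finset.empty_subset _

/-- **The new datum does not involve the contact letter**: `f ∉ φ⁺.vars` if `f ∉ ψ.vars`. [folklore] -/
theorem not_mem_vars_tschShift {ψ : MvPolynomial (Fin 4) K} (hψ : f ∉ ψ.vars) (b : Fin 4 → K) :
    f ∉ (translate b ψ - C (MvPolynomial.eval b ψ)).vars := by
  classical
  intro h
  rcases Finset.mem_union.mp (MvPolynomial.vars_sub_subset _ h) with h1 | h1
  · exact hψ (vars_translate_subset b ψ h1)
  · rw [MvPolynomial.vars_C] at h1
    exact Finset.notMem_empty _ h1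

variable (p : ℕ) [hp : Fact p.Prime] [CharP K p] [DecidableEq K]

/-- **THE FRAME REPRODUCES — residual polynomial.**  For a presented state `s`, a free contact letter `f`,
a datum `φ` (`φ(0) = 0`), a chart `j ≠ f` and a point `b`, with `φ′`, `b⁺`, `φ⁺` as in `pointTransform_tsch`:
`(step p univ j b ⟨tsch f φ s.F, s.r, s.exc⟩).F = deletePthPowers p (tsch f φ⁺ (step p univ j b⁺ s).F)` — the
child of the re-coordinatised state is the re-coordinatised child, re-cleaned (cleaning commutes with the
move up to re-cleaning). [cite: Hauser2010, §§F–G (point blowup followed by cleaning)] [folklore] -/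
theorem step_F_tsch {s : State K} (hq : (p : ℕ∞) ≤ ordZero s.F) (hjf : j ≠ f) (h0 : constantCoeff φ = 0)
    (b : Fin 4 → K) :
    (step p Finset.univ j b ⟨tsch f φ s.F, s.r, s.exc⟩).F =
      deletePthPowers p (tsch f (translate b (chartTransform 1 Finset.univ j φ) -
          C (MvPolynomial.eval b (chartTransform 1 Finset.univ j φ)))
        (step p Finset.univ j
          (Function.update b f (b f + MvPolynomial.eval b (chartTransform 1 Finset.univ j φ))) s).F) := by
  change deletePthPowers p (pointTransform p Finset.univ j b ⟨tsch f φ s.F, s.r, s.exc⟩) =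
    deletePthPowers p (tsch f _ (deletePthPowers p (pointTransform p Finset.univ j _ s)))
  rw [pointTransform_tsch hq hjf h0 b, tsch, Straightening.deletePthPowers_aeval_deletePthPowers]

omit hp [CharP K p] in
/-- **THE FRAME REPRODUCES — multiplicities** (`f` free: `r_f = 0`; `f ∉ φ.vars`, `φ(0) = 0`): the new
multiplicities of the re-coordinatised step are those of the step at `b⁺`. [cite: Hauser2010, §F (transform D')] [folklore] -/
theorem step_r_tsch {q : ℕ} {s : State K} (hφ : f ∉ φ.vars) (h0 : constantCoeff φ = 0) (hr : s.r f = 0)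
    (j : Fin 4) (b : Fin 4 → K) :
    (step q Finset.univ j b ⟨tsch f φ s.F, s.r, s.exc⟩).r =
      (step q Finset.univ j
        (Function.update b f (b f + MvPolynomial.eval b (chartTransform 1 Finset.univ j φ))) s).r := by
  change newMult q Finset.univ j b ⟨tsch f φ s.F, s.r, s.exc⟩ = newMult q Finset.univ j _ s
  unfold newMult
  dsimp only
  rw [ordAlong_univ, ordAlong_univ, ordZero_tsch hφ h0]
  congr 1
  ext i
  rw [Finsupp.filter_apply, Finsupp.filter_apply]
  by_cases hif : i = f
  · subst hif; simp [hr]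
  · rw [Function.update_of_ne hif]

omit hp [CharP K p] in
/-- **THE FRAME REPRODUCES — boundary components** (`f ∉ exc`): the components through the new point are
those of the step at `b⁺`. [cite: Hauser2010, §F (transform D')] [folklore] -/
theorem step_exc_tsch {q : ℕ} {s : State K} (he : f ∉ s.exc) (j : Fin 4) (b : Fin 4 → K) :
    (step q Finset.univ j b ⟨tsch f φ s.F, s.r, s.exc⟩).exc =
      (step q Finset.univ j
        (Function.update b f (b f + MvPolynomial.eval b (chartTransform 1 Finset.univ j φ))) s).exc := by
  change newExc j b ⟨tsch f φ s.F, s.r, s.exc⟩ = newExc j _ s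
  unfold newExc
  dsimp only
  congr 1
  refine Finset.filter_congr fun i hi => ?_
  have hif : i ≠ f := fun h => he (h ▸ hi)
  rw [Function.update_of_ne hif]

/-! ## 6. Equimultiple points and `Step0` edges correspond -/

omit [DecidableEq K] in
/-- Undoing the move after a cleaning and re-cleaning gives back the cleaning:
`clean (tsch f (−φ) (clean (tsch f φ G))) = clean G`. [cite: Hauser2010, §G (cleaning)] [folklore] -/
theorem deletePthPowers_tsch_neg_deletePthPowers_tsch (hφ : f ∉ φ.vars) (G : MvPolynomial (Fin 4) K) :
    deletePthPowers p (tsch f (-φ) (deletePthPowers p (tsch f φ G))) = deletePthPowers p G := by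
  rw [show tsch f (-φ) (deletePthPowers p (tsch f φ G)) =
      aeval (fun i => if i = f then X f + -φ else X i) (deletePthPowers p (tsch f φ G)) from rfl,
    Straightening.deletePthPowers_aeval_deletePthPowers, ← tsch, tsch_neg_tsch hφ]

omit [DecidableEq K] in
/-- For a CLEAN `G`, the order test `n ≤ ord₀` is the same for `G` and for `clean (tsch f φ G)`. [folklore] -/
theorem le_ordZero_deletePthPowers_tsch_iff (hφ : f ∉ φ.vars) (h0 : constantCoeff φ = 0)
    {G : MvPolynomial (Fin 4) K} (hG : deletePthPowers p G = G) (n : ℕ) :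
    (n : ℕ∞) ≤ ordZero (deletePthPowers p (tsch f φ G)) ↔ (n : ℕ∞) ≤ ordZero G := by
  constructor
  · intro h
    rw [← hG, ← deletePthPowers_tsch_neg_deletePthPowers_tsch p hφ G]
    refine h.trans ((ordZero_le_ordZero_tsch (f := f) (φ := -φ) (by rw [map_neg, h0, neg_zero]) _).trans ?_)
    exact ZooCert.J001.le_ordZero_deletePthPowers p _
  · intro h
    exact h.trans ((ordZero_le_ordZero_tsch h0 G).trans (ZooCert.J001.le_ordZero_deletePthPowers p _))

omit [DecidableEq K] in
/-- For a CLEAN `G`, `clean (tsch f φ G) = 0 ↔ G = 0`. [folklore] -/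
theorem deletePthPowers_tsch_eq_zero_iff (hφ : f ∉ φ.vars) {G : MvPolynomial (Fin 4) K}
    (hG : deletePthPowers p G = G) : deletePthPowers p (tsch f φ G) = 0 ↔ G = 0 := by
  constructor
  · intro h
    rw [← hG, ← deletePthPowers_tsch_neg_deletePthPowers_tsch p hφ G, h, map_zero, deletePthPowers_zero]
  · rintro rfl
    rw [map_zero, deletePthPowers_zero]

/-- **Equimultiple points correspond under `b ↦ b⁺`.** [cite: Hauser2010, §F (equiconstant points)] [folklore] -/
theorem isEquimultiplePoint_tsch_iff {s : State K} (hq : (p : ℕ∞) ≤ ordZero s.F) (hjf : j ≠ f)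
    (hφ : f ∉ φ.vars) (h0 : constantCoeff φ = 0) (b : Fin 4 → K) :
    IsEquimultiplePoint p Finset.univ j b ⟨tsch f φ s.F, s.r, s.exc⟩ ↔
      IsEquimultiplePoint p Finset.univ j
        (Function.update b f (b f + MvPolynomial.eval b (chartTransform 1 Finset.univ j φ))) s := by
  rw [Equimultiple.isEquimultiplePoint_iff_le_ordZero_step, Equimultiple.isEquimultiplePoint_iff_le_ordZero_step,
    step_F_tsch p hq hjf h0 b]
  refine le_ordZero_deletePthPowers_tsch_iff p
    (not_mem_vars_tschShift (not_mem_vars_chartTransform 1 _ hjf hφ) b) (constantCoeff_tschShift b _) ?_ p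
  exact PointBlowup.deletePthPowers_deletePthPowers p _

/-- **Non-degeneracy corresponds**: the re-coordinatised child has `F ≠ 0` iff the child at `b⁺` has.
[folklore] -/
theorem step_F_tsch_ne_zero_iff {s : State K} (hq : (p : ℕ∞) ≤ ordZero s.F) (hjf : j ≠ f)
    (hφ : f ∉ φ.vars) (h0 : constantCoeff φ = 0) (b : Fin 4 → K) :
    (step p Finset.univ j b ⟨tsch f φ s.F, s.r, s.exc⟩).F ≠ 0 ↔
      (step p Finset.univ j
        (Function.update b f (b f + MvPolynomial.eval b (chartTransform 1 Finset.univ j φ))) s).F ≠ 0 := by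
  have hG : deletePthPowers p (step p Finset.univ j
      (Function.update b f (b f + MvPolynomial.eval b (chartTransform 1 Finset.univ j φ))) s).F =
      (step p Finset.univ j
        (Function.update b f (b f + MvPolynomial.eval b (chartTransform 1 Finset.univ j φ))) s).F :=
    PointBlowup.deletePthPowers_deletePthPowers p _
  rw [step_F_tsch p hq hjf h0 b, Ne, deletePthPowers_tsch_eq_zero_iff p
    (not_mem_vars_tschShift (not_mem_vars_chartTransform 1 _ hjf hφ) b) hG]

/-- **`Step0` edges correspond**: if `b⁺` is an equimultiple point of chart `j ≠ f` above `s` with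
non-degenerate child, then the re-coordinatised state `⟨tsch f φ s.F, s.r, s.exc⟩` steps (MODE 0, chart `j`,
point `b`) to its child, whose data are given by `step_F_tsch` / `step_r_tsch` / `step_exc_tsch`.
[cite: Hauser2010, §§F–G] [folklore] -/
theorem step0_tsch {s : State K} (hq : (p : ℕ∞) ≤ ordZero s.F) (hjf : j ≠ f) (hφ : f ∉ φ.vars)
    (h0 : constantCoeff φ = 0) {b : Fin 4 → K} (hbj : b j = 0)
    (heq : IsEquimultiplePoint p Finset.univ j
      (Function.update b f (b f + MvPolynomial.eval b (chartTransform 1 Finset.univ j φ))) s)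
    (hne : (step p Finset.univ j
      (Function.update b f (b f + MvPolynomial.eval b (chartTransform 1 Finset.univ j φ))) s).F ≠ 0) :
    Step0 p ⟨tsch f φ s.F, s.r, s.exc⟩ (step p Finset.univ j b ⟨tsch f φ s.F, s.r, s.exc⟩) := by
  refine ⟨?_, j, b, Finset.mem_univ j, hbj, (isEquimultiplePoint_tsch_iff p hq hjf hφ h0 b).mpr heq,
    (step_F_tsch_ne_zero_iff p hq hjf hφ h0 b).mpr hne, rfl⟩
  change (p : ℕ∞) ≤ ordAlong Finset.univ (tsch f φ s.F)
  rw [ordAlong_univ]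
  exact hq.trans (ordZero_le_ordZero_tsch h0 s.F)

end Step


end FrameChange

end Summit.ResolutionOfSingularities.ResolutionOfSingularities.Theorems.PIDim4

end
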